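import Literature.RepresentationTheory.Semisimple.Semisimplification
import Literature.NumberTheory.GaloisRepresentations.GaloisRep
import Mathlib.Topology.Instances.Matrix
import Mathlib.LinearAlgebra.Matrix.Basis
import HarnessLib

/-!
# Continuous dévissage with the frame
(crux `IrreducibilityBySelfDuality.IrreducibleOffSector`, item stmt-Langlands-14329, line `Sketch`,
stub `stub_frameDevissage`)

For a topological group `G`, a topological field `k` and a CONTINUOUS homomorphism
`ψ : G →ₜ* GL_n(k)` (units topology), a proper non-zero `ψ`-stable subspace `W ⊆ kⁿ` gives a FRAME
`P ∈ GL_n(k)` conjugating `ψ` into block upper triangular form along a splitting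
`Fin m ⊕ Fin p ≃ Fin n` (`0 < m, p < n`), with CONTINUOUS diagonal blocks `A : G →ₜ* GL_m(k)`,
`D : G →ₜ* GL_p(k)`:  `P ψ(g) P⁻¹ = reindex (fromBlocks (A g) (B g) 0 (D g))` for all `g`
(`stub_frameDevissage`).  This is the tree's continuous dévissage step
`IrreducibleGL3CM.exists_continuous_blocks_of_subrepresentation` (itself the continuous form of
`Literature.RepresentationTheory.Semisimple.exists_blocks_of_subrepresentation`) with the conjugating
frame recorded: in a basis `b` adapted to `kⁿ = W ⊕ C` the matrices of `ψ` are `P₀ ψ(g) Q₀` for the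
FIXED mutually inverse change-of-basis matrices `P₀ = b.toMatrix e₀`, `Q₀ = e₀.toMatrix b`
(`basis_toMatrix_mul_linearMap_toMatrix_mul_basis_toMatrix`, `Module.Basis.toMatrix_mul_toMatrix_flip`),
and reindexing `P₀`, `Q₀` along `Fin m ⊕ Fin p ≃ Fin n` gives the frame `P = ⟨P₀, Q₀⟩ ∈ GL_n(k)`.

References: C. W. Curtis, I. Reiner, *Methods of Representation Theory* I (1981), §16B; N. Bourbaki,
*Algèbre* VIII (2012), § 20 n° 6.
-/

noncomputable section

-- `Summit.Langlands.Langlands.…` (summit = sub-problem name) trips `dupNamespace` on every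
-- declaration; the project-wide lakefile option is repeated here for stand-alone elaboration.
set_option linter.dupNamespace false

open Matrix Module
open Literature.NumberTheory.GaloisRepresentations

namespace Summit.Langlands.Langlands.Theorems.IrreducibleOffSector

/-- **Continuous dévissage with the frame** (stub `stub_frameDevissage` of line `Sketch`).  If the
representation of `G` on `kⁿ` through a continuous `ψ : G →ₜ* GL_n(k)` has a proper non-zero
subrepresentation `W`, then there are `0 < m, p < n`, a splitting `e : Fin m ⊕ Fin p ≃ Fin n`, a frame
`P ∈ GL_n(k)` and CONTINUOUS `A : G →ₜ* GL_m(k)`, `D : G →ₜ* GL_p(k)`, `B : G → M_{m×p}(k)` with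
`P ψ(g) P⁻¹ = reindex e e (fromBlocks (A g) (B g) 0 (D g))` for every `g`.  The proof is the tree's
`exists_continuous_blocks_of_subrepresentation` (adapted basis `b` of `kⁿ = W ⊕ C`, matrices
`P₀ ψ(g) Q₀` with `P₀ Q₀ = 1 = Q₀ P₀`) with the frame `P = reindex P₀` made explicit.
Curtis–Reiner, *Methods* I, §16B. [folklore] -/
theorem stub_frameDevissage :
    ∀ {k : Type} [Field k] [TopologicalSpace k] [IsTopologicalRing k]
      {G : Type} [Group G] [TopologicalSpace G] {n : ℕ} (ψ : G →ₜ* GL (Fin n) k)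
      (W : Subrepresentation (FramedRep.toRepresentation ψ)), W ≠ ⊥ → W ≠ ⊤ →
      ∃ (m p : ℕ) (_ : m < n) (_ : p < n) (_ : 0 < m) (_ : 0 < p) (e : Fin m ⊕ Fin p ≃ Fin n)
        (P : GL (Fin n) k) (A : G →ₜ* GL (Fin m) k) (D : G →ₜ* GL (Fin p) k)
        (B : G → Matrix (Fin m) (Fin p) k),
        ∀ g, ((FramedRep.conj P ψ g : GL (Fin n) k) : Matrix (Fin n) (Fin n) k) =
          Matrix.reindex e e (Matrix.fromBlocks ((A g : GL (Fin m) k) : Matrix (Fin m) (Fin m) k)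
            (B g) 0 ((D g : GL (Fin p) k) : Matrix (Fin p) (Fin p) k)) := by
  intro k _ _ _ G _ _ n ψ W hW0 hW1
  classical
  -- the representation `R` on `kⁿ` (a `let`, definitionally the one of which `W` is a
  -- subrepresentation)
  let R : Representation k G (Fin n → k) := FramedRep.toRepresentation ψ
  have hRapply : ∀ (g : G) (v : Fin n → k),
      R g v = ((ψ g : GL (Fin n) k) : Matrix (Fin n) (Fin n) k) *ᵥ v := fun _ _ ↦ rfl
  have hRlin : ∀ g, (R g : (Fin n → k) →ₗ[k] (Fin n → k)) =
      Matrix.toLin' ((ψ g : GL (Fin n) k) : Matrix (Fin n) (Fin n) k) := fun g ↦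
    LinearMap.ext fun v ↦ by rw [Matrix.toLin'_apply, hRapply]
  -- the stable subspace `W` and a complement `C`
  have hbot : (⊥ : Subrepresentation R).toSubmodule = ⊥ := rfl
  have htop : (⊤ : Subrepresentation R).toSubmodule = ⊤ := rfl
  have hWS0 : W.toSubmodule ≠ ⊥ := fun h ↦
    hW0 (Subrepresentation.toSubmodule_injective (h.trans hbot.symm))
  have hWS1 : W.toSubmodule ≠ ⊤ := fun h ↦
    hW1 (Subrepresentation.toSubmodule_injective (h.trans htop.symm))
  obtain ⟨C, hWC⟩ := Submodule.exists_isCompl W.toSubmodule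
  obtain ⟨m, hm⟩ : ∃ m, finrank k W.toSubmodule = m := ⟨_, rfl⟩
  obtain ⟨p, hp⟩ : ∃ p, finrank k C = p := ⟨_, rfl⟩
  have hmp : m + p = n := by
    rw [← hm, ← hp, Submodule.finrank_add_eq_of_isCompl hWC, Module.finrank_fin_fun]
  have hm0 : 0 < m := by
    refine Nat.pos_of_ne_zero fun h ↦ hWS0 ?_
    exact Submodule.finrank_eq_zero.mp (hm.trans h)
  have hp0 : 0 < p := by
    refine Nat.pos_of_ne_zero fun h ↦ hWS1 ?_
    have hC : C = ⊥ := Submodule.finrank_eq_zero.mp (hp.trans h)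
    have := hWC.sup_eq_top
    rwa [hC, sup_bot_eq] at this
  have hmn : m < n := by omega
  have hpn : p < n := by omega
  -- an adapted basis `b`
  let bW : Module.Basis (Fin m) k W.toSubmodule := Module.finBasisOfFinrankEq k W.toSubmodule hm
  let bC : Module.Basis (Fin p) k C := Module.finBasisOfFinrankEq k C hp
  let f : (W.toSubmodule × C) ≃ₗ[k] (Fin n → k) := Submodule.prodEquivOfIsCompl W.toSubmodule C hWC
  let b : Module.Basis (Fin m ⊕ Fin p) k (Fin n → k) := (bW.prod bC).map f
  have hrepr : ∀ w : Fin n → k, w ∈ W.toSubmodule → ∀ i : Fin p, b.repr w (Sum.inr i) = 0 := by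
    intro w hw i
    have h1 : b.repr w = (bW.prod bC).repr (f.symm w) := by
      simp only [b, Module.Basis.map_repr, LinearEquiv.trans_apply]
    have h2 : f.symm w = ((⟨w, hw⟩ : W.toSubmodule), 0) :=
      Submodule.prodEquivOfIsCompl_symm_apply_left (p := W.toSubmodule) (q := C) hWC
        (⟨w, hw⟩ : W.toSubmodule)
    rw [h1, h2, Module.Basis.prod_repr_inr]
    simp
  have hb_inl : ∀ j : Fin m, (b (Sum.inl j) : Fin n → k) ∈ W.toSubmodule := by
    intro j
    have : b (Sum.inl j) = f ((bW.prod bC) (Sum.inl j)) := by simp [b]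
    rw [this, Submodule.coe_prodEquivOfIsCompl', Module.Basis.prod_apply_inl_fst,
      Module.Basis.prod_apply_inl_snd]
    simp
  -- matrices in the adapted basis: `M g = P₀ ψ(g) Q₀` for fixed mutually inverse `P₀`, `Q₀`
  let e₀ : Module.Basis (Fin n) k (Fin n → k) := Pi.basisFun k (Fin n)
  let P₀ : Matrix (Fin m ⊕ Fin p) (Fin n) k := b.toMatrix e₀
  let Q₀ : Matrix (Fin n) (Fin m ⊕ Fin p) k := e₀.toMatrix b
  have hPQ₀ : P₀ * Q₀ = 1 := b.toMatrix_mul_toMatrix_flip e₀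
  have hQP₀ : Q₀ * P₀ = 1 := e₀.toMatrix_mul_toMatrix_flip b
  let M : G → Matrix (Fin m ⊕ Fin p) (Fin m ⊕ Fin p) k := fun g ↦ LinearMap.toMatrix b b (R g)
  have hM_eq : ∀ g, M g = P₀ * ((ψ g : GL (Fin n) k) : Matrix (Fin n) (Fin n) k) * Q₀ := by
    intro g
    have h1 : LinearMap.toMatrix e₀ e₀ (R g : (Fin n → k) →ₗ[k] (Fin n → k)) =
        ((ψ g : GL (Fin n) k) : Matrix (Fin n) (Fin n) k) := by
      rw [hRlin, show LinearMap.toMatrix e₀ e₀ = LinearMap.toMatrix' from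
        LinearMap.toMatrix_eq_toMatrix', LinearMap.toMatrix'_toLin']
    simp only [M, P₀, Q₀]
    rw [← h1, basis_toMatrix_mul_linearMap_toMatrix_mul_basis_toMatrix]
  have hM_inv : ∀ g, M g⁻¹ = P₀ * (((ψ g)⁻¹ : GL (Fin n) k) : Matrix (Fin n) (Fin n) k) * Q₀ := by
    intro g
    rw [hM_eq, map_inv]
  have hM_cont : Continuous M := by
    rw [show M = fun g ↦ P₀ * ((ψ g : GL (Fin n) k) : Matrix (Fin n) (Fin n) k) * Q₀ from
      funext hM_eq]
    exact (continuous_const.matrix_mul (Units.continuous_val.comp ψ.continuous_toFun)).matrix_mul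
      continuous_const
  have hM_cont_inv : Continuous fun g ↦ M g⁻¹ := by
    rw [show (fun g ↦ M g⁻¹) = fun g ↦
      P₀ * (((ψ g)⁻¹ : GL (Fin n) k) : Matrix (Fin n) (Fin n) k) * Q₀ from funext hM_inv]
    exact (continuous_const.matrix_mul (Units.continuous_coe_inv.comp ψ.continuous_toFun)).matrix_mul
      continuous_const
  have hM_mul : ∀ g h, M (g * h) = M g * M h := fun g h ↦ by
    simp only [M, map_mul]
    exact LinearMap.toMatrix_mul b _ _
  have hM_one : M 1 = 1 := by
    simp only [M, map_one]
    exact LinearMap.toMatrix_one b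
  have h21 : ∀ g, (M g).toBlocks₂₁ = 0 := by
    intro g
    ext i j
    change M g (Sum.inr i) (Sum.inl j) = 0
    simp only [M, LinearMap.toMatrix_apply]
    exact hrepr _ (W.apply_mem_toSubmodule g (hb_inl j)) i
  -- the diagonal blocks are multiplicative and continuous
  let A₀ : G → Matrix (Fin m) (Fin m) k := fun g ↦ (M g).toBlocks₁₁
  let B₀ : G → Matrix (Fin m) (Fin p) k := fun g ↦ (M g).toBlocks₁₂
  let D₀ : G → Matrix (Fin p) (Fin p) k := fun g ↦ (M g).toBlocks₂₂
  have hA₀_cont : Continuous A₀ :=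
    continuous_matrix fun i j ↦ hM_cont.matrix_elem (Sum.inl i) (Sum.inl j)
  have hD₀_cont : Continuous D₀ :=
    continuous_matrix fun i j ↦ hM_cont.matrix_elem (Sum.inr i) (Sum.inr j)
  have hA₀_cont_inv : Continuous fun g ↦ A₀ g⁻¹ :=
    continuous_matrix fun i j ↦ hM_cont_inv.matrix_elem (Sum.inl i) (Sum.inl j)
  have hD₀_cont_inv : Continuous fun g ↦ D₀ g⁻¹ :=
    continuous_matrix fun i j ↦ hM_cont_inv.matrix_elem (Sum.inr i) (Sum.inr j)
  have hblock : ∀ g, M g = Matrix.fromBlocks (A₀ g) (B₀ g) 0 (D₀ g) := fun g ↦ by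
    conv_lhs => rw [← Matrix.fromBlocks_toBlocks (M g), h21 g]
  have hmul : ∀ g h, A₀ (g * h) = A₀ g * A₀ h ∧ D₀ (g * h) = D₀ g * D₀ h := by
    intro g h
    have e1 := hM_mul g h
    rw [hblock, hblock, hblock, Matrix.fromBlocks_multiply] at e1
    obtain ⟨hA, -, -, hD⟩ := Matrix.fromBlocks_inj.mp e1
    refine ⟨?_, ?_⟩
    · rw [hA, Matrix.mul_zero, add_zero]
    · rw [hD, Matrix.zero_mul, zero_add]
  have hone : A₀ 1 = 1 ∧ D₀ 1 = 1 := by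
    have e1 := hM_one
    rw [hblock, ← Matrix.fromBlocks_one] at e1
    obtain ⟨hA, -, -, hD⟩ := Matrix.fromBlocks_inj.mp e1
    exact ⟨hA, hD⟩
  -- as continuous homomorphisms into `GL`
  let A : G →ₜ* GL (Fin m) k :=
    { toFun := fun g ↦ ⟨A₀ g, A₀ g⁻¹, by rw [← (hmul _ _).1, mul_inv_cancel, hone.1],
        by rw [← (hmul _ _).1, inv_mul_cancel, hone.1]⟩
      map_one' := Units.ext hone.1
      map_mul' := fun g h ↦ Units.ext (hmul g h).1
      continuous_toFun := Units.continuous_iff.2 ⟨hA₀_cont, hA₀_cont_inv⟩ }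
  let D : G →ₜ* GL (Fin p) k :=
    { toFun := fun g ↦ ⟨D₀ g, D₀ g⁻¹, by rw [← (hmul _ _).2, mul_inv_cancel, hone.2],
        by rw [← (hmul _ _).2, inv_mul_cancel, hone.2]⟩
      map_one' := Units.ext hone.2
      map_mul' := fun g h ↦ Units.ext (hmul g h).2
      continuous_toFun := Units.continuous_iff.2 ⟨hD₀_cont, hD₀_cont_inv⟩ }
  -- the frame: `P₀`, `Q₀` reindexed along `e : Fin m ⊕ Fin p ≃ Fin n`
  let e : Fin m ⊕ Fin p ≃ Fin n := finSumFinEquiv.trans (finCongr hmp)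
  let P' : Matrix (Fin n) (Fin n) k := P₀.submatrix e.symm _root_.id
  let Q' : Matrix (Fin n) (Fin n) k := Q₀.submatrix _root_.id e.symm
  have hPQ' : P' * Q' = 1 := by
    simp only [P', Q']
    rw [← Matrix.submatrix_mul P₀ Q₀ e.symm _root_.id e.symm Function.bijective_id, hPQ₀,
      Matrix.submatrix_one_equiv]
  have hQP' : Q' * P' = 1 := by
    simp only [P', Q']
    rw [Matrix.submatrix_mul_equiv Q₀ P₀ _root_.id e.symm _root_.id, hQP₀, Matrix.submatrix_id_id]
  have hconj : ∀ g, P' * ((ψ g : GL (Fin n) k) : Matrix (Fin n) (Fin n) k) * Q' =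
      Matrix.reindex e e (M g) := by
    intro g
    rw [hM_eq, Matrix.reindex_apply,
      Matrix.submatrix_mul _ Q₀ e.symm _root_.id e.symm Function.bijective_id,
      Matrix.submatrix_mul P₀ _ e.symm _root_.id _root_.id Function.bijective_id,
      Matrix.submatrix_id_id]
  let Pfr : GL (Fin n) k := ⟨P', Q', hPQ', hQP'⟩
  refine ⟨m, p, hmn, hpn, hm0, hp0, e, Pfr, A, D, B₀, fun g ↦ ?_⟩
  change P' * ((ψ g : GL (Fin n) k) : Matrix (Fin n) (Fin n) k) * Q' =
    Matrix.reindex e e (Matrix.fromBlocks (A₀ g) (B₀ g) 0 (D₀ g))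
  rw [← hblock g]
  exact hconj g

end Summit.Langlands.Langlands.Theorems.IrreducibleOffSector

end
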